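import Mathlib
import HarnessLib

/-!
# Type-I main term for Bateman–Horn (stmt-Parity-0873), input C:
# Dirichlet's hyperbola method with rates for Dirichlet convolutions

Abstract real-variable lemmas (nothing specific to polynomials). For arithmetic functions
`f, g : ArithmeticFunction ℝ` write `F(N) = ∑_{n ≤ N} f(n)`, `G`, and `W(N) = ∑_{n ≤ N} (f ⋆ g)(n)`.

* `sum_Ioc_mul_eq_hyperbola` — **Dirichlet's hyperbola identity** with an integer split `z ≤ N`:
  `W(N) = ∑_{x ≤ z} f(x) G(N/x) + ∑_{y ≤ N/(z+1)} g(y) (F(N/y) − F(z))` (natural division).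
* the quantitative convergence package used throughout is the pair of bounds
  `|F(N) − α| ≤ K/(1 + log N)^A` and `∑_{n ≤ N} |f(n)| ≤ M (1 + log N)^a` for all `N ≥ 1`;
* `hasLogRate_mul` — **rates for a convolution**: if `f, g` have the package with rate `A` and
  variation exponents `a, b ≤ A` then `f ⋆ g` has it with limit `αβ`, rate `A − max a b` and
  variation exponent `a + b` (hyperbola method at `z = ⌊√N⌋`);
* `hasLogRate_prod` — the `k`-fold version for `∏_{i : Fin k} f_i` (rate `A − k(k+2)` when every
  factor has variation exponent `≤ 2`).

These feed the evaluation of the `k`-dimensional log-weighted singular series of the Type-I main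
term (`…SingularSeries.lean`). Everything here is proved. [folklore]
-/

noncomputable section

open Finset ArithmeticFunction

namespace Summit.Parity.BatemanHorn.Theorems.TypeIMainTerm

/-! ### The hyperbola identity -/

/-- **Dirichlet's hyperbola identity** (integer split point `z ≤ N`, natural division):
`∑_{n ≤ N} (f ⋆ g)(n) = ∑_{x ≤ z} f(x) G(N/x) + ∑_{y ≤ N/(z+1)} g(y) (F(N/y) − F(z))`,
`F(t) = ∑_{n ≤ t} f(n)`, `G(t) = ∑_{n ≤ t} g(n)`. [folklore] -/
theorem sum_Ioc_mul_eq_hyperbola {R : Type*} [CommRing R] (f g : ArithmeticFunction R) {N z : ℕ}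
    (hz : z ≤ N) :
    ∑ n ∈ Ioc 0 N, (f * g) n =
      ∑ x ∈ Ioc 0 z, f x * ∑ y ∈ Ioc 0 (N / x), g y +
        ∑ y ∈ Ioc 0 (N / (z + 1)), g y * (∑ x ∈ Ioc 0 (N / y), f x - ∑ x ∈ Ioc 0 z, f x) := by
  classical
  rw [sum_Ioc_mul_eq_sum_sum, ← Finset.sum_Ioc_consecutive _ (Nat.zero_le z) hz]
  congr 1
  -- the terms with `z < x ≤ N`, written over the box `Ioc z N × Ioc 0 (N/(z+1))`
  have key : ∀ x ∈ Ioc z N, f x * ∑ y ∈ Ioc 0 (N / x), g y =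
      ∑ y ∈ Ioc 0 (N / (z + 1)), if x * y ≤ N then f x * g y else 0 := by
    intro x hx
    obtain ⟨hzx, hxN⟩ := Finset.mem_Ioc.mp hx
    have hx0 : 0 < x := by omega
    rw [Finset.mul_sum, ← Finset.sum_filter]
    refine Finset.sum_congr ?_ fun _ _ => rfl
    ext y
    simp only [Finset.mem_Ioc, Finset.mem_filter]
    constructor
    · rintro ⟨hy0, hyx⟩
      have hxy : x * y ≤ N := by
        have := (Nat.le_div_iff_mul_le hx0).mp hyx
        rwa [mul_comm] at this
      refine ⟨⟨hy0, ?_⟩, hxy⟩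
      exact (Nat.le_div_iff_mul_le (Nat.succ_pos z)).mpr
        (le_trans (Nat.mul_le_mul_left y (by omega : z + 1 ≤ x)) (by rwa [mul_comm] at hxy))
    · rintro ⟨⟨hy0, -⟩, hxy⟩
      exact ⟨hy0, (Nat.le_div_iff_mul_le hx0).mpr (by rwa [mul_comm] at hxy)⟩
  rw [Finset.sum_congr rfl key, Finset.sum_comm]
  refine Finset.sum_congr rfl fun y hy => ?_
  obtain ⟨hy0, hyz⟩ := Finset.mem_Ioc.mp hy
  have hzy : z ≤ N / y := by
    refine (Nat.le_div_iff_mul_le hy0).mpr ?_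
    have h1 := (Nat.le_div_iff_mul_le (Nat.succ_pos z)).mp hyz
    calc z * y ≤ (z + 1) * y := Nat.mul_le_mul_right y (Nat.le_succ z)
      _ = y * (z + 1) := mul_comm _ _
      _ ≤ N := h1
  have hNy : N / y ≤ N := Nat.div_le_self N y
  have hfilter : (Ioc z N).filter (fun x => x * y ≤ N) = Ioc z (N / y) := by
    ext x
    simp only [Finset.mem_filter, Finset.mem_Ioc]
    constructor
    · rintro ⟨⟨h1, -⟩, h3⟩
      exact ⟨h1, (Nat.le_div_iff_mul_le hy0).mpr h3⟩
    · rintro ⟨h1, h2⟩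
      exact ⟨⟨h1, h2.trans hNy⟩, (Nat.le_div_iff_mul_le hy0).mp h2⟩
  rw [← Finset.sum_filter, hfilter, ← Finset.sum_mul, mul_comm,
    ← Finset.sum_Ioc_consecutive _ (Nat.zero_le z) hzy]
  ring


/-! ### The convergence package with logarithmic rates -/

/-- `1 ≤ 1 + log N` for `N ≥ 1`. -/
theorem one_le_one_add_log {N : ℕ} (hN : 1 ≤ N) : 1 ≤ 1 + Real.log N := by
  have : 0 ≤ Real.log N := Real.log_nonneg (by exact_mod_cast hN)
  linarith

/-- Monotonicity of the rate function: `K/(1 + log m)^A ≤ K/(1 + log z)^A` for `1 ≤ z ≤ m`. -/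
theorem div_one_add_log_pow_le {K : ℝ} (hK : 0 ≤ K) (A : ℕ) {z m : ℕ} (hz : 1 ≤ z) (hzm : z ≤ m) :
    K / (1 + Real.log m) ^ A ≤ K / (1 + Real.log z) ^ A := by
  have hz1 := one_le_one_add_log hz
  refine div_le_div_of_nonneg_left hK (by positivity) (pow_le_pow_left₀ (by linarith) ?_ A)
  have : Real.log z ≤ Real.log m :=
    Real.log_le_log (by exact_mod_cast hz) (by exact_mod_cast hzm)
  linarith

/-- The integer square root as split point: `1 ≤ z ≤ N`, `z ≤ N/z`, and
`1 + log N ≤ 4 (1 + log z)` (`N < (z+1)² ≤ 4z²`). -/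
theorem sqrt_facts {N : ℕ} (hN : 1 ≤ N) :
    1 ≤ Nat.sqrt N ∧ Nat.sqrt N ≤ N ∧ Nat.sqrt N ≤ N / Nat.sqrt N ∧
      1 + Real.log N ≤ 4 * (1 + Real.log (Nat.sqrt N)) := by
  set z := Nat.sqrt N with hz
  have hz1 : 1 ≤ z := Nat.le_sqrt.mpr (by simpa using hN)
  have hzN : z ≤ N := Nat.sqrt_le_self N
  have hzz : z ≤ N / z := (Nat.le_div_iff_mul_le (by omega)).mpr (Nat.sqrt_le N)
  refine ⟨hz1, hzN, hzz, ?_⟩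
  have hlt : N < (z + 1) * (z + 1) := Nat.lt_succ_sqrt N
  have h4 : (N : ℝ) ≤ 4 * (z : ℝ) ^ 2 := by
    have h1 : (N : ℝ) ≤ ((z : ℝ) + 1) ^ 2 := by exact_mod_cast (by nlinarith : N ≤ (z + 1) ^ 2)
    have hz1' : (1 : ℝ) ≤ z := by exact_mod_cast hz1
    have h2 : (z : ℝ) + 1 ≤ 2 * z := by linarith
    nlinarith
  have hz0 : (0 : ℝ) < z := by exact_mod_cast hz1
  have hlog : Real.log N ≤ Real.log 4 + 2 * Real.log z := by
    calc Real.log N ≤ Real.log (4 * (z : ℝ) ^ 2) :=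
          Real.log_le_log (by exact_mod_cast hN) h4
      _ = Real.log 4 + 2 * Real.log z := by
          rw [Real.log_mul (by norm_num) (by positivity), Real.log_pow]; push_cast; ring
  have hlog4 : Real.log 4 ≤ 3 := by
    have := Real.log_le_sub_one_of_pos (by norm_num : (0 : ℝ) < 4)
    linarith
  have hlogz : 0 ≤ Real.log z := Real.log_nonneg (by exact_mod_cast hz1)
  linarith

/-- For `y ≤ N/(z+1)` (`y ≥ 1`): `z ≤ N/y`. -/
theorem le_div_of_le_div_succ {N z y : ℕ} (hy0 : 0 < y) (hyz : y ≤ N / (z + 1)) : z ≤ N / y := by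
  refine (Nat.le_div_iff_mul_le hy0).mpr ?_
  have h1 := (Nat.le_div_iff_mul_le (Nat.succ_pos z)).mp hyz
  calc z * y ≤ (z + 1) * y := Nat.mul_le_mul_right y (Nat.le_succ z)
    _ = y * (z + 1) := mul_comm _ _
    _ ≤ N := h1

/-- **Variation of a convolution**: `∑_{n ≤ N} |(f ⋆ g)(n)| ≤ (∑_{n ≤ N} |f(n)|)(∑_{n ≤ N} |g(n)|)`. -/
theorem sum_abs_mul_le (f g : ArithmeticFunction ℝ) (N : ℕ) :
    ∑ n ∈ Ioc 0 N, |(f * g) n| ≤ (∑ n ∈ Ioc 0 N, |f n|) * ∑ n ∈ Ioc 0 N, |g n| := by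
  classical
  set f' : ArithmeticFunction ℝ := ⟨fun n => |f n|, by simp⟩ with hf'
  set g' : ArithmeticFunction ℝ := ⟨fun n => |g n|, by simp⟩ with hg'
  have h1 : ∀ n, |(f * g) n| ≤ (f' * g') n := by
    intro n
    simp only [mul_apply]
    refine (Finset.abs_sum_le_sum_abs _ _).trans (le_of_eq ?_)
    refine Finset.sum_congr rfl fun x _ => ?_
    rw [abs_mul]; rfl
  calc ∑ n ∈ Ioc 0 N, |(f * g) n| ≤ ∑ n ∈ Ioc 0 N, (f' * g') n := Finset.sum_le_sum fun n _ => h1 n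
    _ = ∑ x ∈ (Ioc 0 N ×ˢ Ioc 0 N).filter (fun x : ℕ × ℕ => x.1 * x.2 ≤ N), f' x.1 * g' x.2 :=
        sum_Ioc_mul_eq_sum_prod_filter f' g' N
    _ ≤ ∑ x ∈ Ioc 0 N ×ˢ Ioc 0 N, f' x.1 * g' x.2 :=
        Finset.sum_le_sum_of_subset_of_nonneg (Finset.filter_subset _ _) fun x _ _ =>
          mul_nonneg (abs_nonneg _) (abs_nonneg _)
    _ = (∑ n ∈ Ioc 0 N, |f n|) * ∑ n ∈ Ioc 0 N, |g n| := by
        rw [Finset.sum_product, Finset.sum_mul]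
        refine Finset.sum_congr rfl fun x _ => ?_
        rw [Finset.mul_sum]
        rfl

/-- **Rates for a Dirichlet convolution (hyperbola method).** If `f` and `g` have the log-rate
package with rate exponent `A`, variation exponents `a, b` (`max a b ≤ A`) and limits `α, β`, then
`f ⋆ g` has it with limit `αβ`, rate exponent `A − max a b`, variation exponent `a + b`:
writing `W(N) − αβ = β(F(z) − α) + ∑_{x ≤ z} f(x)(G(N/x) − β) + ∑_{y ≤ N/(z+1)} g(y)((F(N/y) − α) − (F(z) − α))`
with `z = ⌊√N⌋`, every error is evaluated at an argument `≥ z`, and `1 + log N ≤ 4(1 + log z)`.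
[folklore] -/
theorem hasLogRate_mul {f g : ArithmeticFunction ℝ} {α β K L M P : ℝ} {A a b : ℕ}
    (hF : ∀ N : ℕ, 1 ≤ N → |∑ n ∈ Ioc 0 N, f n - α| ≤ K / (1 + Real.log N) ^ A)
    (hVf : ∀ N : ℕ, 1 ≤ N → ∑ n ∈ Ioc 0 N, |f n| ≤ M * (1 + Real.log N) ^ a)
    (hG : ∀ N : ℕ, 1 ≤ N → |∑ n ∈ Ioc 0 N, g n - β| ≤ L / (1 + Real.log N) ^ A)
    (hVg : ∀ N : ℕ, 1 ≤ N → ∑ n ∈ Ioc 0 N, |g n| ≤ P * (1 + Real.log N) ^ b)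
    (hK : 0 ≤ K) (hL : 0 ≤ L) (hM : 0 ≤ M) (hP : 0 ≤ P) (hab : max a b ≤ A) :
    (∀ N : ℕ, 1 ≤ N → |∑ n ∈ Ioc 0 N, (f * g) n - α * β| ≤
        (4 : ℝ) ^ A * (|β| * K + M * L + 2 * P * K) / (1 + Real.log N) ^ (A - max a b)) ∧
      (∀ N : ℕ, 1 ≤ N → ∑ n ∈ Ioc 0 N, |(f * g) n| ≤ M * P * (1 + Real.log N) ^ (a + b)) := by
  refine ⟨fun N hN => ?_, fun N hN => ?_⟩
  · obtain ⟨hz1, hzN, hzz, hlog4⟩ := sqrt_facts hN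
    set z := Nat.sqrt N with hz
    set ℓ : ℝ := 1 + Real.log N with hℓ
    set ℓz : ℝ := 1 + Real.log z with hℓz
    have hℓ1 : 1 ≤ ℓ := one_le_one_add_log hN
    have hℓz1 : 1 ≤ ℓz := one_le_one_add_log hz1
    have hℓzℓ : ℓz ≤ ℓ := by
      have : Real.log z ≤ Real.log N := Real.log_le_log (by exact_mod_cast hz1) (by exact_mod_cast hzN)
      simp only [hℓ, hℓz]; linarith
    -- notation for partial sums
    set F : ℕ → ℝ := fun t => ∑ n ∈ Ioc 0 t, f n with hFdef
    set G : ℕ → ℝ := fun t => ∑ n ∈ Ioc 0 t, g n with hGdef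
    have hid := sum_Ioc_mul_eq_hyperbola f g hzN
    -- rewrite `W − αβ`
    have hW : ∑ n ∈ Ioc 0 N, (f * g) n - α * β =
        β * (F z - α) + ∑ x ∈ Ioc 0 z, f x * (G (N / x) - β) +
          ∑ y ∈ Ioc 0 (N / (z + 1)), g y * ((F (N / y) - α) - (F z - α)) := by
      rw [hid]
      simp only [hFdef, hGdef, mul_sub, Finset.sum_sub_distrib, ← Finset.sum_mul]
      ring
    rw [hW]
    -- the three error terms
    have e1 : |β * (F z - α)| ≤ |β| * K / ℓz ^ A := by
      rw [abs_mul, mul_div_assoc]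
      exact mul_le_mul_of_nonneg_left (hF z hz1) (abs_nonneg _)
    have e2 : |∑ x ∈ Ioc 0 z, f x * (G (N / x) - β)| ≤ M * ℓ ^ a * (L / ℓz ^ A) := by
      calc |∑ x ∈ Ioc 0 z, f x * (G (N / x) - β)|
          ≤ ∑ x ∈ Ioc 0 z, |f x * (G (N / x) - β)| := Finset.abs_sum_le_sum_abs _ _
        _ ≤ ∑ x ∈ Ioc 0 z, |f x| * (L / ℓz ^ A) := by
            refine Finset.sum_le_sum fun x hx => ?_
            obtain ⟨hx0, hxz⟩ := Finset.mem_Ioc.mp hx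
            rw [abs_mul]
            refine mul_le_mul_of_nonneg_left ?_ (abs_nonneg _)
            have hzx : z ≤ N / x := hzz.trans (Nat.div_le_div_left hxz hx0)
            have h1x : 1 ≤ N / x := hz1.trans hzx
            exact (hG (N / x) h1x).trans (div_one_add_log_pow_le hL A hz1 hzx)
        _ = (∑ x ∈ Ioc 0 z, |f x|) * (L / ℓz ^ A) := by rw [Finset.sum_mul]
        _ ≤ M * ℓ ^ a * (L / ℓz ^ A) := by
            refine mul_le_mul_of_nonneg_right ?_ (by positivity)
            exact (hVf z hz1).trans (mul_le_mul_of_nonneg_left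
              (pow_le_pow_left₀ (by linarith) hℓzℓ a) hM)
    have e3 : |∑ y ∈ Ioc 0 (N / (z + 1)), g y * ((F (N / y) - α) - (F z - α))| ≤
        P * ℓ ^ b * (2 * K / ℓz ^ A) := by
      rcases Nat.eq_zero_or_pos (N / (z + 1)) with h0 | hpos
      · rw [h0]; simp; positivity
      calc |∑ y ∈ Ioc 0 (N / (z + 1)), g y * ((F (N / y) - α) - (F z - α))|
          ≤ ∑ y ∈ Ioc 0 (N / (z + 1)), |g y * ((F (N / y) - α) - (F z - α))| :=
            Finset.abs_sum_le_sum_abs _ _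
        _ ≤ ∑ y ∈ Ioc 0 (N / (z + 1)), |g y| * (2 * K / ℓz ^ A) := by
            refine Finset.sum_le_sum fun y hy => ?_
            obtain ⟨hy0, hyz⟩ := Finset.mem_Ioc.mp hy
            rw [abs_mul]
            refine mul_le_mul_of_nonneg_left ?_ (abs_nonneg _)
            have hzy : z ≤ N / y := le_div_of_le_div_succ hy0 hyz
            have h1 : |F (N / y) - α| ≤ K / ℓz ^ A :=
              (hF (N / y) (hz1.trans hzy)).trans (div_one_add_log_pow_le hK A hz1 hzy)
            have h2 : |F z - α| ≤ K / ℓz ^ A := hF z hz1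
            calc |(F (N / y) - α) - (F z - α)| ≤ |F (N / y) - α| + |F z - α| := abs_sub _ _
              _ ≤ K / ℓz ^ A + K / ℓz ^ A := add_le_add h1 h2
              _ = 2 * K / ℓz ^ A := by ring
        _ = (∑ y ∈ Ioc 0 (N / (z + 1)), |g y|) * (2 * K / ℓz ^ A) := by rw [Finset.sum_mul]
        _ ≤ P * ℓ ^ b * (2 * K / ℓz ^ A) := by
            refine mul_le_mul_of_nonneg_right ?_ (by positivity)
            refine (hVg _ hpos).trans (mul_le_mul_of_nonneg_left (pow_le_pow_left₀ (by
              linarith [one_le_one_add_log hpos]) ?_ b) hP)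
            have : Real.log ((N / (z + 1) : ℕ) : ℝ) ≤ Real.log N :=
              Real.log_le_log (by exact_mod_cast hpos) (by exact_mod_cast Nat.div_le_self N (z + 1))
            simp only [hℓ]; linarith
    -- assemble: everything over `ℓz^A ≥ ℓ^A / 4^A`
    have hmax : ℓ ^ a ≤ ℓ ^ max a b ∧ ℓ ^ b ≤ ℓ ^ max a b :=
      ⟨pow_le_pow_right₀ hℓ1 (le_max_left a b), pow_le_pow_right₀ hℓ1 (le_max_right a b)⟩
    have hℓzA : ℓ ^ A ≤ (4 : ℝ) ^ A * ℓz ^ A := by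
      rw [← mul_pow]; exact pow_le_pow_left₀ (by linarith) hlog4 A
    set S : ℝ := |β| * K + M * L + 2 * P * K with hS
    have hS0 : 0 ≤ S := by positivity
    have hℓm1 : 1 ≤ ℓ ^ max a b := one_le_pow₀ hℓ1
    have hℓzA0 : 0 < ℓz ^ A := by positivity
    have hsum : |β| * K / ℓz ^ A + M * ℓ ^ a * (L / ℓz ^ A) + P * ℓ ^ b * (2 * K / ℓz ^ A) ≤
        S * ℓ ^ max a b / ℓz ^ A := by
      have t1 : |β| * K / ℓz ^ A ≤ |β| * K * ℓ ^ max a b / ℓz ^ A :=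
        div_le_div_of_nonneg_right (le_mul_of_one_le_right (by positivity) hℓm1) hℓzA0.le
      have t2 : M * ℓ ^ a * (L / ℓz ^ A) ≤ M * L * ℓ ^ max a b / ℓz ^ A := by
        rw [mul_div_assoc', div_le_div_iff_of_pos_right hℓzA0]
        nlinarith [hmax.1, mul_nonneg hM hL]
      have t3 : P * ℓ ^ b * (2 * K / ℓz ^ A) ≤ 2 * P * K * ℓ ^ max a b / ℓz ^ A := by
        rw [mul_div_assoc', div_le_div_iff_of_pos_right hℓzA0]
        nlinarith [hmax.2, mul_nonneg hP hK]
      have : |β| * K * ℓ ^ max a b / ℓz ^ A + M * L * ℓ ^ max a b / ℓz ^ A +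
          2 * P * K * ℓ ^ max a b / ℓz ^ A = S * ℓ ^ max a b / ℓz ^ A := by
        rw [hS]; ring
      linarith
    have hfin : S * ℓ ^ max a b / ℓz ^ A ≤ (4 : ℝ) ^ A * S / ℓ ^ (A - max a b) := by
      rw [div_le_div_iff₀ hℓzA0 (by positivity)]
      have e : ℓ ^ A = ℓ ^ (A - max a b) * ℓ ^ max a b := by
        rw [← pow_add, Nat.sub_add_cancel hab]
      calc S * ℓ ^ max a b * ℓ ^ (A - max a b) = S * ℓ ^ A := by rw [e]; ring
        _ ≤ S * ((4 : ℝ) ^ A * ℓz ^ A) := mul_le_mul_of_nonneg_left hℓzA hS0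
        _ = (4 : ℝ) ^ A * S * ℓz ^ A := by ring
    calc |β * (F z - α) + ∑ x ∈ Ioc 0 z, f x * (G (N / x) - β) +
          ∑ y ∈ Ioc 0 (N / (z + 1)), g y * ((F (N / y) - α) - (F z - α))|
        ≤ |β * (F z - α)| + |∑ x ∈ Ioc 0 z, f x * (G (N / x) - β)| +
          |∑ y ∈ Ioc 0 (N / (z + 1)), g y * ((F (N / y) - α) - (F z - α))| := abs_add_three _ _ _
      _ ≤ |β| * K / ℓz ^ A + M * ℓ ^ a * (L / ℓz ^ A) + P * ℓ ^ b * (2 * K / ℓz ^ A) :=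
          add_le_add (add_le_add e1 e2) e3
      _ ≤ S * ℓ ^ max a b / ℓz ^ A := hsum
      _ ≤ (4 : ℝ) ^ A * S / ℓ ^ (A - max a b) := hfin
      _ = (4 : ℝ) ^ A * (|β| * K + M * L + 2 * P * K) / (1 + Real.log N) ^ (A - max a b) := by
          rw [hS]
  · exact (sum_abs_mul_le f g N).trans (by
      rw [pow_add, mul_mul_mul_comm]
      exact mul_le_mul (hVf N hN) (hVg N hN) (Finset.sum_nonneg fun _ _ => abs_nonneg _)
        (by have := one_le_one_add_log hN; positivity))

/-- Weakening the rate exponent: `K/(1 + log N)^{e₁} ≤ K/(1 + log N)^{e₂}` for `e₂ ≤ e₁`. -/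
theorem div_one_add_log_pow_le_of_le {K : ℝ} (hK : 0 ≤ K) {N : ℕ} (hN : 1 ≤ N) {e₁ e₂ : ℕ}
    (h : e₂ ≤ e₁) : K / (1 + Real.log N) ^ e₁ ≤ K / (1 + Real.log N) ^ e₂ :=
  div_le_div_of_nonneg_left hK (by have := one_le_one_add_log hN; positivity)
    (pow_le_pow_right₀ (one_le_one_add_log hN) h)

/-- **Rates for a `k`-fold Dirichlet convolution.** If each `f_i` (`i < k`) has partial sums
`α_i + O(K/(1 + log N)^A)` and variation `≤ M (1 + log N)²` (`M ≥ 1`), and `k(k+2) ≤ A`, then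
`∏ f_i` has partial sums `∏ α_i + O(K'/(1 + log N)^{A − k(k+2)})` and variation
`≤ M^k (1 + log N)^{2k}`. [folklore] -/
theorem hasLogRate_prod (k : ℕ) (f : Fin k → ArithmeticFunction ℝ) (α : Fin k → ℝ) (A : ℕ)
    (K M : ℝ) (hK : 0 ≤ K) (hM : 1 ≤ M) (hA : k * (k + 2) ≤ A)
    (hF : ∀ i, ∀ N : ℕ, 1 ≤ N → |∑ n ∈ Ioc 0 N, f i n - α i| ≤ K / (1 + Real.log N) ^ A)
    (hV : ∀ i, ∀ N : ℕ, 1 ≤ N → ∑ n ∈ Ioc 0 N, |f i n| ≤ M * (1 + Real.log N) ^ 2) :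
    ∃ K' : ℝ, 0 ≤ K' ∧
      (∀ N : ℕ, 1 ≤ N → |∑ n ∈ Ioc 0 N, (∏ i, f i) n - ∏ i, α i| ≤
        K' / (1 + Real.log N) ^ (A - k * (k + 2))) ∧
      (∀ N : ℕ, 1 ≤ N → ∑ n ∈ Ioc 0 N, |(∏ i, f i) n| ≤ M ^ k * (1 + Real.log N) ^ (2 * k)) := by
  induction k generalizing A with
  | zero =>
    refine ⟨0, le_rfl, fun N hN => ?_, fun N hN => ?_⟩
    · simp only [Finset.univ_eq_empty, Finset.prod_empty, zero_div]
      rw [show ∑ n ∈ Ioc 0 N, (1 : ArithmeticFunction ℝ) n = 1 from ?_]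
      · simp
      rw [Finset.sum_eq_single 1 (fun n _ hn => by simp [one_apply, hn]) (fun h => by
        exfalso; exact h (Finset.mem_Ioc.mpr ⟨Nat.one_pos, hN⟩))]
      simp
    · simp only [Finset.univ_eq_empty, Finset.prod_empty, pow_zero, mul_zero, one_mul]
      rw [Finset.sum_eq_single 1 (fun n _ hn => by simp [one_apply, hn]) (fun h => by
        exfalso; exact h (Finset.mem_Ioc.mpr ⟨Nat.one_pos, hN⟩))]
      simp
  | succ k ih =>
    have hA' : k * (k + 2) ≤ A := le_trans (Nat.mul_le_mul (Nat.le_succ k) (by omega)) hA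
    obtain ⟨Kk, hKk0, hFk, hVk⟩ := ih (fun i => f i.succ) (fun i => α i.succ) A hA'
      (fun i => hF i.succ) (fun i => hV i.succ)
    set A₀ := A - k * (k + 2) with hA₀
    have hM0 : 0 ≤ M := by linarith
    -- the first factor, with its rate weakened to `A₀`
    have hF0 : ∀ N : ℕ, 1 ≤ N → |∑ n ∈ Ioc 0 N, f 0 n - α 0| ≤ K / (1 + Real.log N) ^ A₀ :=
      fun N hN => (hF 0 N hN).trans (div_one_add_log_pow_le_of_le hK hN (Nat.sub_le _ _))
    have hmax : max 2 (2 * k) ≤ A₀ := by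
      rw [hA₀]
      have : (k + 1) * (k + 1 + 2) ≤ A := hA
      rcases Nat.lt_or_ge k 1 with hk | hk
      · interval_cases k; omega
      · have h1 : max 2 (2 * k) = 2 * k := max_eq_right (by omega)
        rw [h1]; 
        have e : (k + 1) * (k + 1 + 2) = k * (k + 2) + (2 * k + 3) := by ring
        omega
    obtain ⟨hR, hVar⟩ := hasLogRate_mul hF0 (hV 0) hFk hVk hK hKk0 hM0 (pow_nonneg hM0 k) hmax
    refine ⟨(4 : ℝ) ^ A₀ * (|∏ i, α (Fin.succ i)| * K + M * Kk + 2 * M ^ k * K), by positivity,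
      fun N hN => ?_, fun N hN => ?_⟩
    · rw [Fin.prod_univ_succ, Fin.prod_univ_succ]
      refine (hR N hN).trans (div_one_add_log_pow_le_of_le (by positivity) hN ?_)
      -- exponents: `A - (k+1)(k+3) ≤ A₀ - max 2 (2k)`
      rw [hA₀]
      have : (k + 1) * (k + 1 + 2) ≤ A := hA
      rcases Nat.lt_or_ge k 1 with hk | hk
      · interval_cases k; omega
      · have h1 : max 2 (2 * k) = 2 * k := max_eq_right (by omega)
        rw [h1]
        have e : (k + 1) * (k + 1 + 2) = k * (k + 2) + (2 * k + 3) := by ring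
        omega
    · rw [Fin.prod_univ_succ, pow_succ, mul_comm (M ^ k) M,
        show 2 * (k + 1) = 2 + 2 * k by ring]
      exact hVar N hN
end Summit.Parity.BatemanHorn.Theorems.TypeIMainTerm

end
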